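import Literature.AlgebraicGeometry.HodgeTheory.CyclicCoverPencilNodeNeighbourhood
import Literature.AlgebraicGeometry.Motives.UniversalHypersurfaceRegularLocusChartFunction
import Literature.AlgebraicGeometry.Motives.UniversalHypersurfaceRegularLocusChartPartial
import Literature.AlgebraicGeometry.Motives.UniversalHypersurfaceRegularLocusFlow
import Literature.AlgebraicGeometry.Motives.UniversalHypersurfaceRegularLocusSubmersion
import HarnessLib

/-!
# The cut-off scalar `(1 − λ)·χ'(b)` on `𝒴°(ℂ)` and the complete flows of the cut-off lifted fields

Family `hodge`, layer `Literature/AlgebraicGeometry/HodgeTheory`; step A1b-γ(iii-b-3) of the programme discharging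
`HodgeTheory/CyclicCoverNodalMeridianLocalMonodromyBound`. With the node cut-off `λ = regChartExtend 2 p 2 (β ∘ y)` (`β ≡ 1` on `‖y‖ < η`, zero for
`‖y‖ > R`) and a coefficient cut-off `χ'` on `ℂ^N` vanishing off a compact `K` over which all fibre-singular points lie in the node neighbourhood `N_η`
(`CyclicCoverPencilNodeNeighbourhood`), the scalar `f = (1 − λ)·χ'(b)` is `C^∞` on `𝒴°(ℂ)` and vanishes off the compact support region
`{b ∈ K, ι(Q) ∉ N_η}`; hence for every `C^∞` vector field `X` on `𝒴°(ℂ)` (e.g. the shell-tangent lifts of `CyclicCoverPencilShellFields`) the field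
`f • X` has a COMPLETE `C^∞` flow (`Motives/UniversalHypersurfaceRegularLocusFlow`).

* `cutoffScalar`, `contMDiff_cutoffScalar`, `cutoffScalar_eq_zero_of_not_mem` (vanishing off the support region), `cutoffScalar_eq_of` (its value
  `χ'(b(Q))` where `λ = 0`);
* `exists_cutoff_globalFlow` — **the complete flow of `f • X`.**

Everything is proved; the one definition is concrete; no named facts.

## References

* [LeeSmoothManifolds2013] J. M. Lee, Introduction to Smooth Manifolds (2013), Thm. 9.16, Lemma 2.26 (bump functions).
* [ArnoldGuseinzadeVarchenko2012] V. I. Arnold, S. M. Gusein-Zade, A. N. Varchenko, Singularities of Differentiable Maps II (2012), Part I §2.1.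
-/

noncomputable section

open CategoryTheory AlgebraicGeometry TopologicalSpace Set Topology
open scoped Manifold ContDiff
open Literature.AlgebraicGeometry.Motives Literature.AlgebraicGeometry.Motives.UniversalHypersurface
open Literature.AlgebraicGeometry.HodgeTheory.UniversalHypersurface

namespace Literature.AlgebraicGeometry.HodgeTheory

variable (p : ℕ) (β : (Fin (2 + 1) → ℂ) → ℝ) (χ' : (DegIndex 2 p → ℂ) → ℝ)

/-- **The cut-off scalar** `f(Q) = (1 − λ(Q))·χ'(b(Q))`, `λ = regChartExtend 2 p 2 (β ∘ y)`. [cite: LeeSmoothManifolds2013, Lemma 2.26] -/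
def cutoffScalar (Q : ComplexPoints (regularTotal ℂ 2 p)) : ℝ :=
  (1 - regChartExtend 2 p 2 (fun v => β (fun j => v (Sum.inr j))) Q) * χ' (regCoeff ℂ 2 p Q)

/-- **The cut-off scalar is `C^∞`** (`β`, `χ'` smooth, `β` zero for `‖y‖ > R`, `p ≥ 1`). [cite: LeeSmoothManifolds2013, Lemma 2.26] -/
theorem contMDiff_cutoffScalar (hd : 0 < p) (hβ : ContDiff ℝ ∞ β) {R : ℝ} (hβR : ∀ y, R < ‖y‖ → β y = 0) (hχ : ContDiff ℝ ∞ χ') :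
    haveI := locallyOfFiniteType_regularTotal_hom ℂ 2 p hd
    haveI := smoothOfRelativeDimension_regularTotal_hom ℂ 2 p hd
    letI := ComplexPoints.chartedSpace (regularTotal ℂ 2 p) (2 + Fintype.card (DegIndex 2 p))
    ContMDiff (𝓡 (2 * (2 + Fintype.card (DegIndex 2 p)))) 𝓘(ℝ, ℝ) ∞ (cutoffScalar p β χ') := by
  haveI := locallyOfFiniteType_regularTotal_hom ℂ 2 p hd
  haveI := smoothOfRelativeDimension_regularTotal_hom ℂ 2 p hd
  letI := ComplexPoints.chartedSpace (regularTotal ℂ 2 p) (2 + Fintype.card (DegIndex 2 p))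
  have hlin : ContDiff ℝ ∞ (fun v : ChartIdx 2 p 2 → ℂ => (fun j : Fin (2 + 1) => v (Sum.inr j))) :=
    contDiff_pi.2 fun j => contDiff_apply ℝ ℂ (Sum.inr j : ChartIdx 2 p 2)
  have hB : ContDiff ℝ ∞ (fun v : ChartIdx 2 p 2 → ℂ => β (fun j => v (Sum.inr j))) := hβ.comp hlin
  have hBR : ∀ v : ChartIdx 2 p 2 → ℂ, R < ‖fun j => v (Sum.inr j)‖ → β (fun j => v (Sum.inr j)) = 0 :=
    fun v hv => hβR _ hv
  have hlam := contMDiff_regChartExtend_real 2 p 2 hd (fun v => β (fun j => v (Sum.inr j))) hB hBR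
  have hg : ContMDiff (𝓡 (2 * (2 + Fintype.card (DegIndex 2 p)))) 𝓘(ℝ, DegIndex 2 p → ℂ) ∞ (fun Q' => regCoeff ℂ 2 p Q') :=
    fun Q => contMDiffAt_regCoeff 2 p hd Q
  have hχg : ContMDiff (𝓡 (2 * (2 + Fintype.card (DegIndex 2 p)))) 𝓘(ℝ, ℝ) ∞ (fun Q' => χ' (regCoeff ℂ 2 p Q')) :=
    hχ.contMDiff.comp hg
  exact (contMDiff_const.sub hlam).mul hχg

/-- **The cut-off scalar vanishes off the support region** `{b(Q) ∈ K, ι(Q) ∉ N_η}` (`χ' = 0` off `K`, `β ≡ 1` on `‖y‖ < η`).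
[cite: LeeSmoothManifolds2013, Thm. 9.16] -/
theorem cutoffScalar_eq_zero_of_not_mem {η : ℝ} (hβ1 : ∀ y, ‖y‖ < η → β y = 1) {K : Set (DegIndex 2 p → ℂ)}
    (hχK : ∀ b, b ∉ K → χ' b = 0) (Q : ComplexPoints (regularTotal ℂ 2 p))
    (hQ : Q ∉ {Q : ComplexPoints (regularTotal ℂ 2 p) |
      regCoeff ℂ 2 p Q ∈ K ∧ AlgPoints.map (regularToTotalSpaceOver ℂ 2 p) Q ∉ nodeNbhd p η}) :
    cutoffScalar p β χ' Q = 0 := by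
  rw [Set.mem_setOf_eq, not_and_or, not_not] at hQ
  rcases hQ with hK | hN
  · rw [cutoffScalar, hχK _ hK, mul_zero]
  · obtain ⟨hdom, hy⟩ := (map_mem_nodeNbhd_iff p η Q).mp hN
    rw [cutoffScalar, regChartExtend_of_mem 2 p 2 _ hdom, hβ1 _ hy, sub_self, zero_mul]

/-- Where the node cut-off vanishes the cut-off scalar is `χ'(b(Q))`. [cite: LeeSmoothManifolds2013, Lemma 2.26] -/
theorem cutoffScalar_eq_of {Q : ComplexPoints (regularTotal ℂ 2 p)}
    (hlam0 : regChartExtend 2 p 2 (fun v => β (fun j => v (Sum.inr j))) Q = 0) :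
    cutoffScalar p β χ' Q = χ' (regCoeff ℂ 2 p Q) := by
  rw [cutoffScalar, hlam0, sub_zero, one_mul]

/-- **The complete flow of the cut-off field `f • X`.** Let `p ≥ 3`, `η > 0`, `β`/`χ'` as above with `χ'` vanishing off a compact `K` contained
in the neighbourhood `V` of `CyclicCoverPencilNodeNeighbourhood.exists_coeff_nhds_singular_subset_nodeNbhd`, and `X` a `C^∞` vector field on
`𝒴°(ℂ)`. Then `cutoffScalar • X` has a complete `C^∞` flow with the group law, whose orbits are its integral curves and which fixes its zeros.
[cite: LeeSmoothManifolds2013, Thm. 9.16] [cite: ArnoldGuseinzadeVarchenko2012, Part I §2.1] -/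
theorem exists_cutoff_globalFlow (hd : 0 < p) {η : ℝ} (hβ : ContDiff ℝ ∞ β) {R : ℝ} (hβR : ∀ y, R < ‖y‖ → β y = 0)
    (hβ1 : ∀ y, ‖y‖ < η → β y = 1) (hχ : ContDiff ℝ ∞ χ')
    {K V : Set (DegIndex 2 p → ℂ)} (hK : IsCompact K) (hKV : K ⊆ V) (hχK : ∀ b, b ∉ K → χ' b = 0)
    (hV : ∀ P : ComplexPoints (totalSpaceOver ℂ 2 p),
      P ∉ Set.range (AlgPoints.map (regularToTotalSpaceOver ℂ 2 p) : ComplexPoints (regularTotal ℂ 2 p) → _) →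
        tCoeff ℂ 2 p P ∈ V → P ∈ nodeNbhd p η)
    (X : haveI := locallyOfFiniteType_regularTotal_hom ℂ 2 p hd
      haveI := smoothOfRelativeDimension_regularTotal_hom ℂ 2 p hd
      letI := ComplexPoints.chartedSpace (regularTotal ℂ 2 p) (2 + Fintype.card (DegIndex 2 p))
      Π Q : ComplexPoints (regularTotal ℂ 2 p), TangentSpace (𝓡 (2 * (2 + Fintype.card (DegIndex 2 p)))) Q)
    (hX : haveI := locallyOfFiniteType_regularTotal_hom ℂ 2 p hd
      haveI := smoothOfRelativeDimension_regularTotal_hom ℂ 2 p hd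
      letI := ComplexPoints.chartedSpace (regularTotal ℂ 2 p) (2 + Fintype.card (DegIndex 2 p))
      haveI := ComplexPoints.isManifold_real (regularTotal ℂ 2 p) (2 + Fintype.card (DegIndex 2 p))
      ContMDiff (𝓡 (2 * (2 + Fintype.card (DegIndex 2 p)))) (𝓡 (2 * (2 + Fintype.card (DegIndex 2 p)))).tangent ∞
        (fun Q => (⟨Q, X Q⟩ : TangentBundle (𝓡 (2 * (2 + Fintype.card (DegIndex 2 p)))) (ComplexPoints (regularTotal ℂ 2 p))))) :
    haveI := locallyOfFiniteType_regularTotal_hom ℂ 2 p hd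
    haveI := smoothOfRelativeDimension_regularTotal_hom ℂ 2 p hd
    letI := ComplexPoints.chartedSpace (regularTotal ℂ 2 p) (2 + Fintype.card (DegIndex 2 p))
    ∃ θ : ℝ × ComplexPoints (regularTotal ℂ 2 p) → ComplexPoints (regularTotal ℂ 2 p),
      ContMDiff (𝓘(ℝ, ℝ).prod (𝓡 (2 * (2 + Fintype.card (DegIndex 2 p))))) (𝓡 (2 * (2 + Fintype.card (DegIndex 2 p)))) ∞ θ ∧
      (∀ Q, θ (0, Q) = Q) ∧ (∀ t s Q, θ (t, θ (s, Q)) = θ (t + s, Q)) ∧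
      (∀ Q, IsMIntegralCurve (fun t => θ (t, Q)) (fun Q' => cutoffScalar p β χ' Q' • X Q')) ∧
      ∀ Q, cutoffScalar p β χ' Q • X Q = 0 → ∀ t, θ (t, Q) = Q :=
  exists_globalFlow_smul_of_isCompact 2 p hd X (cutoffScalar p β χ') hX (contMDiff_cutoffScalar p β χ' hd hβ hβR hχ)
    (isCompact_supportRegion p η hK hKV hV) (fun Q hQ => cutoffScalar_eq_zero_of_not_mem p β χ' hβ1 hχK Q hQ)

end Literature.AlgebraicGeometry.HodgeTheory

end
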